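import Mathlib

/-!
# Crux `TateFamilyKernel` (stmt-KontsevichZagierPeriods-9130), line `Sketch`:
# stub `stub_towerBind` (wave 13 — the `θ`-tower under the reparametrisation `ϖ = ϖ₀t^d`)

Pure `MvPolynomial` algebra. The face families of a quasi-homogeneous pencil live at the
`(s, ϖ)`-level (`X 0 = s`, `X 1 = ϖ`, polynomials in `MvPolynomial (Fin (1 + 1)) ℚ`); the KZ
certificate lives on the `(s, t)`-square after the reparametrisation `ϖ = ϖ₀t^d`, i.e. after the
substitution `φ := bind₁ ![X 0, X 2 * X 1 ^ d]` into `MvPolynomial (Fin (2 + 1)) ℚ`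
(`X 0 = s`, `X 1 = t`, `X 2 ↦ ϖ₀`). The tower recursion uses `θ = ϖ∂_ϖ = X 1 * pderiv 1` at the
`(s, ϖ)`-level and `δ = t∂_t = X 1 * pderiv 1` at the `(s, t, ϖ₀)`-level, and `δ ∘ φ = d · φ ∘ θ`.

* `TowerBind.pderiv_bind₁` — the chain rule for `pderiv` under `bind₁`
  (`∂ⱼ(p ∘ f) = Σᵢ (∂ᵢp ∘ f) · ∂ⱼfᵢ`, induction on `p`; adapted from the `dirDeriv` chain rule
  of `Literature.AlgebraicGeometry.Motives.PolyFormPullback`);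
* `TowerBind.X_mul_pderiv_bind₁` — `t∂_t(φ p) = d · ϖ₀t^d · φ(∂_ϖ p)`, i.e. `δ(φ p) = d·φ(θ p)`;
* `TowerBind.tower_step` — one step of the tower: `d^{i+1}·φ(θ-step of N over D)` is the
  `δ`-step of `d^i·φ N` over `φ D`;
* `stub_towerBind` — the two conjuncts (`i = 0`: `φ` fixes the face data; `i + 1`: `tower_step`).

All identities are stated in `MvPolynomial (Fin (2 + 1)) ℚ` (the type of the tower `M` of
`stub_eulerBandMulti`). Mathlib only; no named fact, no new definition. Helpers live in the
sub-namespace `TowerBind`.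
-/

noncomputable section

open MeasureTheory Set MvPolynomial

namespace Summit.KontsevichZagierPeriods.InverseLandau.TateFamilyKernel.Descent

namespace TowerBind

/-- **Chain rule for `pderiv` under `bind₁`.** For `f : Fin m → R[σ]` and `p ∈ R[y₀,…,y_{m-1}]`,
`∂ⱼ (p(f)) = Σᵢ (∂ᵢ p)(f) · ∂ⱼ fᵢ`. Induction on `p`. [folklore] -/
theorem pderiv_bind₁ {σ R : Type*} [CommRing R] {m : ℕ} (f : Fin m → MvPolynomial σ R) (j : σ)
    (p : MvPolynomial (Fin m) R) :
    pderiv j (bind₁ f p) = ∑ i, bind₁ f (pderiv i p) * pderiv j (f i) := by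
  -- adapted from `Literature.AlgebraicGeometry.Motives.AffineDeRham.dirDeriv_bind₁`
  induction p using MvPolynomial.induction_on with
  | C a => simp only [bind₁_C_right, pderiv_C, map_zero, zero_mul, Finset.sum_const_zero]
  | add p q hp hq => simp only [map_add, hp, hq, add_mul, Finset.sum_add_distrib]
  | mul_X p i hp =>
    have h1 : ∀ i', bind₁ f (pderiv i' (p * X i)) * pderiv j (f i') =
        f i * (bind₁ f (pderiv i' p) * pderiv j (f i')) +
          (if i = i' then bind₁ f p * pderiv j (f i') else 0) := by
      intro i'
      rw [pderiv_mul, pderiv_X, map_add, map_mul, map_mul, bind₁_X_right, Pi.single_apply]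
      split_ifs with h
      · simp only [map_one, mul_one]; ring
      · simp only [map_zero, mul_zero, add_zero]; ring
    rw [Finset.sum_congr rfl fun i' _ => h1 i', Finset.sum_add_distrib, Finset.sum_ite_eq,
      if_pos (Finset.mem_univ i), ← Finset.mul_sum, ← hp, map_mul, bind₁_X_right, pderiv_mul]
    ring

/-- Euler on a monomial: `Xᵢ · ∂ᵢ(Xᵢ^d) = d · Xᵢ^d` (also for `d = 0`). [folklore] -/
theorem X_mul_pderiv_X_pow {σ : Type*} (i : σ) (d : ℕ) :
    X i * pderiv i ((X i : MvPolynomial σ ℚ) ^ d) = C (d : ℚ) * X i ^ d := by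
  induction d with
  | zero => simp only [pow_zero, pderiv_one, mul_zero, Nat.cast_zero, C_0, zero_mul]
  | succ n ih =>
    rw [pow_succ, pderiv_mul, pderiv_X_self, mul_add, ← mul_assoc, ih, Nat.cast_succ, C_add, C_1]
    ring

/-! The reparametrisation `φ = bind₁ ![X 0, X 2 * X 1 ^ d] : ℚ[s, ϖ] → ℚ[s, t, ϖ₀]`. The source is
written `MvPolynomial (Fin (1 + 1)) ℚ` and the target `MvPolynomial (Fin (2 + 1)) ℚ`, exactly as in
the statement of `stub_towerBind`, so that the lemmas below rewrite its goals syntactically. -/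

/-- `φ 1 = 1`. [folklore] -/
theorem bind₁_one (d : ℕ) :
    (bind₁ ![X 0, X 2 * X 1 ^ d] (1 : MvPolynomial (Fin (1 + 1)) ℚ) : MvPolynomial (Fin (2 + 1)) ℚ) =
      1 :=
  map_one _

/-- `φ` sends `ϖ` to `ϖ₀t^d`: `φ (X 1) = X 2 * X 1 ^ d`. [folklore] -/
theorem bind₁_X_one (d : ℕ) :
    (bind₁ ![X 0, X 2 * X 1 ^ d] (X 1 : MvPolynomial (Fin (1 + 1)) ℚ) : MvPolynomial (Fin (2 + 1)) ℚ) =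
      X 2 * X 1 ^ d := by
  rw [bind₁_X_right, Matrix.cons_val_one, Matrix.cons_val_zero]

/-- `φ` fixes the `z₀ = 1` face data: `φ (p(1, s)) = p(1, s)`. [folklore] -/
theorem bind₁_face_zero (d : ℕ) (p : MvPolynomial (Fin 2) ℚ) :
    (bind₁ ![X 0, X 2 * X 1 ^ d] (bind₁ ![C 1, X 0] p : MvPolynomial (Fin (1 + 1)) ℚ) :
        MvPolynomial (Fin (2 + 1)) ℚ) = bind₁ ![C 1, X 0] p := by
  rw [bind₁_bind₁]
  congr 2
  funext i
  fin_cases i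
  · simp
  · simp

/-- `φ` fixes the `z₁ = 1` face data: `φ (p(s, 1)) = p(s, 1)`. [folklore] -/
theorem bind₁_face_one (d : ℕ) (p : MvPolynomial (Fin 2) ℚ) :
    (bind₁ ![X 0, X 2 * X 1 ^ d] (bind₁ ![X 0, C 1] p : MvPolynomial (Fin (1 + 1)) ℚ) :
        MvPolynomial (Fin (2 + 1)) ℚ) = bind₁ ![X 0, C 1] p := by
  rw [bind₁_bind₁]
  congr 2
  funext i
  fin_cases i
  · simp
  · simp

/-- `φ` maps the `(s, ϖ)`-denominator `D = (1 − ϖT(1,s))(1 − ϖT(s,1))` to the face denominator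
`D_{ab} = (1 − ϖ₀t^dT(1,s))(1 − ϖ₀t^dT(s,1))` of the reparametrised pencil. [folklore] -/
theorem bind₁_den (d : ℕ) (T : MvPolynomial (Fin 2) ℚ) :
    (bind₁ ![X 0, X 2 * X 1 ^ d]
        ((1 - X 1 * bind₁ ![C 1, X 0] T) * (1 - X 1 * bind₁ ![X 0, C 1] T) :
          MvPolynomial (Fin (1 + 1)) ℚ) : MvPolynomial (Fin (2 + 1)) ℚ) =
      (1 - X 2 * X 1 ^ d * bind₁ ![C 1, X 0] T) * (1 - X 2 * X 1 ^ d * bind₁ ![X 0, C 1] T) := by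
  simp only [map_mul, map_sub, bind₁_one, bind₁_X_one, bind₁_face_zero, bind₁_face_one]

/-- `φ` maps the `(s, ϖ)`-face family `a·P(1,s)·(1 − ϖT(s,1)) + b·P(s,1)·(1 − ϖT(1,s))` to the
reparametrised face family (`ϖ ↦ ϖ₀t^d`). [folklore] -/
theorem bind₁_faceFamily (a b d : ℕ) (T P : MvPolynomial (Fin 2) ℚ) :
    (bind₁ ![X 0, X 2 * X 1 ^ d]
        (C (a : ℚ) * bind₁ ![C 1, X 0] P * (1 - X 1 * bind₁ ![X 0, C 1] T) +
            C (b : ℚ) * bind₁ ![X 0, C 1] P * (1 - X 1 * bind₁ ![C 1, X 0] T) :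
          MvPolynomial (Fin (1 + 1)) ℚ) : MvPolynomial (Fin (2 + 1)) ℚ) =
      C (a : ℚ) * bind₁ ![C 1, X 0] P * (1 - X 2 * X 1 ^ d * bind₁ ![X 0, C 1] T) +
        C (b : ℚ) * bind₁ ![X 0, C 1] P * (1 - X 2 * X 1 ^ d * bind₁ ![C 1, X 0] T) := by
  simp only [map_add, map_mul, map_sub, bind₁_C_right, bind₁_one, bind₁_X_one, bind₁_face_zero,
    bind₁_face_one]

/-- **`δ ∘ φ = d · φ ∘ θ`.** For every `p ∈ ℚ[s, ϖ]`:
`t · ∂_t (φ p) = d · (ϖ₀t^d) · φ (∂_ϖ p)` (chain rule along `ϖ = ϖ₀t^d`; both sides vanish for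
`d = 0`). [folklore] -/
theorem X_mul_pderiv_bind₁ (d : ℕ) (p : MvPolynomial (Fin (1 + 1)) ℚ) :
    (X 1 * pderiv 1 (bind₁ ![X 0, X 2 * X 1 ^ d] p) : MvPolynomial (Fin (2 + 1)) ℚ) =
      C (d : ℚ) * (X 2 * X 1 ^ d) * bind₁ ![X 0, X 2 * X 1 ^ d] (pderiv 1 p) := by
  have h20 : (2 : Fin (2 + 1)) ≠ 1 := by decide
  have h01 : (0 : Fin (2 + 1)) ≠ 1 := by decide
  rw [pderiv_bind₁, Fin.sum_univ_two]
  simp only [Matrix.cons_val_zero, Matrix.cons_val_one, pderiv_X_of_ne h01, mul_zero, zero_add,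
    pderiv_mul, pderiv_X_of_ne h20, zero_mul]
  have h := X_mul_pderiv_X_pow (1 : Fin (2 + 1)) d
  linear_combination
    (bind₁ ![X 0, X 2 * X 1 ^ d] (pderiv 1 p) * X 2 : MvPolynomial (Fin (2 + 1)) ℚ) * h

/-- **One step of the tower under `φ`.** For `N, D ∈ ℚ[s, ϖ]`:
`d^{i+1} · φ(ϖ·(∂_ϖN·D − (i+1)·N·∂_ϖD)) = t·(∂_t(d^i φN)·φD − (i+1)·(d^i φN)·∂_t(φD))`. [folklore] -/
theorem tower_step (d i : ℕ) (N D : MvPolynomial (Fin (1 + 1)) ℚ) :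
    (C ((d : ℚ) ^ (i + 1)) *
        bind₁ ![X 0, X 2 * X 1 ^ d] (X 1 * (pderiv 1 N * D - C ((i : ℚ) + 1) * N * pderiv 1 D)) :
          MvPolynomial (Fin (2 + 1)) ℚ) =
      X 1 *
        (pderiv 1 (C ((d : ℚ) ^ i) * bind₁ ![X 0, X 2 * X 1 ^ d] N) * bind₁ ![X 0, X 2 * X 1 ^ d] D -
          C ((i : ℚ) + 1) * (C ((d : ℚ) ^ i) * bind₁ ![X 0, X 2 * X 1 ^ d] N) *
            pderiv 1 (bind₁ ![X 0, X 2 * X 1 ^ d] D)) := by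
  have kN := X_mul_pderiv_bind₁ d N
  have kD := X_mul_pderiv_bind₁ d D
  rw [pderiv_C_mul, pow_succ, C_mul]
  simp only [map_mul, map_sub, bind₁_C_right, bind₁_X_one]
  linear_combination
    (-(C ((d : ℚ) ^ i) * bind₁ ![X 0, X 2 * X 1 ^ d] D : MvPolynomial (Fin (2 + 1)) ℚ)) * kN +
      (C ((i : ℚ) + 1) * C ((d : ℚ) ^ i) * bind₁ ![X 0, X 2 * X 1 ^ d] N :
        MvPolynomial (Fin (2 + 1)) ℚ) * kD

end TowerBind

/-- STUB `stub_towerBind` (wave 13). **The tower under the reparametrisation `ϖ = ϖ₀t^d`.** If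
`Ns w i / D^{i+1}` is the `θ = ϖ∂_ϖ`-tower of the face family at the `(s,ϖ)`-level (`X 0 = s`,
`X 1 = ϖ`; `Ns w (i+1) = X₁·(∂₁(Ns w i)·D − (i+1)·(Ns w i)·∂₁D)`, `D = (1 − ϖT(1,s))(1 − ϖT(s,1))`),
then `M w i := d^i · (Ns w i)(s, ϖ₀t^d)` (substitution `bind₁ ![X 0, X 2 * X 1 ^ d]` into
`ℚ[s, t, ϖ₀] = MvPolynomial (Fin (2 + 1)) ℚ`) is the `δ = t∂_t`-tower of `stub_eulerBandMulti`
(chain rule `t∂_t = d·ϖ∂_ϖ` for `bind₁`, `TowerBind.X_mul_pderiv_bind₁`). [folklore] -/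
theorem stub_towerBind (a b d : ℕ) (T : MvPolynomial (Fin 2) ℚ) (Pw : ℕ → MvPolynomial (Fin 2) ℚ)
    (Ns : ℕ → ℕ → MvPolynomial (Fin (1 + 1)) ℚ)
    (hNs0 : ∀ w, Ns w 0 =
      C (a : ℚ) * bind₁ ![C 1, X 0] (Pw w) * (1 - X 1 * bind₁ ![X 0, C 1] T) +
        C (b : ℚ) * bind₁ ![X 0, C 1] (Pw w) * (1 - X 1 * bind₁ ![C 1, X 0] T))
    (hNsS : ∀ w i, Ns w (i + 1) =
      X 1 * (pderiv 1 (Ns w i) * ((1 - X 1 * bind₁ ![C 1, X 0] T) * (1 - X 1 * bind₁ ![X 0, C 1] T)) -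
        C ((i : ℚ) + 1) * Ns w i * pderiv 1 ((1 - X 1 * bind₁ ![C 1, X 0] T) * (1 - X 1 * bind₁ ![X 0, C 1] T)))) :
    (∀ w, (C ((d : ℚ) ^ 0) * bind₁ ![X 0, X 2 * X 1 ^ d] (Ns w 0) : MvPolynomial (Fin (2 + 1)) ℚ) =
      C (a : ℚ) * bind₁ ![C 1, X 0] (Pw w) * (1 - X 2 * X 1 ^ d * bind₁ ![X 0, C 1] T) + C (b : ℚ) * bind₁ ![X 0, C 1] (Pw w) * (1 - X 2 * X 1 ^ d * bind₁ ![C 1, X 0] T)) ∧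
    (∀ w i, (C ((d : ℚ) ^ (i + 1)) * bind₁ ![X 0, X 2 * X 1 ^ d] (Ns w (i + 1)) : MvPolynomial (Fin (2 + 1)) ℚ) =
      X 1 * (pderiv 1 (C ((d : ℚ) ^ i) * bind₁ ![X 0, X 2 * X 1 ^ d] (Ns w i)) * ((1 - X 2 * X 1 ^ d * bind₁ ![C 1, X 0] T) * (1 - X 2 * X 1 ^ d * bind₁ ![X 0, C 1] T)) -
        C ((i : ℚ) + 1) * (C ((d : ℚ) ^ i) * bind₁ ![X 0, X 2 * X 1 ^ d] (Ns w i)) * pderiv 1 ((1 - X 2 * X 1 ^ d * bind₁ ![C 1, X 0] T) * (1 - X 2 * X 1 ^ d * bind₁ ![X 0, C 1] T)))) := by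
  refine ⟨fun w => ?_, fun w i => ?_⟩
  · -- `i = 0`: `φ` fixes the face data and `φ (X 1) = ϖ₀t^d`; `d^0 = 1`
    rw [hNs0, TowerBind.bind₁_faceFamily, pow_zero, C_1, one_mul]
  · -- `i + 1`: one tower step, then `φ D = D_{ab}`
    rw [hNsS, TowerBind.tower_step, TowerBind.bind₁_den]

end Summit.KontsevichZagierPeriods.InverseLandau.TateFamilyKernel.Descent

end
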